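import Summits.QuantumFields.YangMills.Theorems.BalabanUVNodesN15KingModelPauliLinksBands
import HarnessLib

/-!
# BalabanUVNodes ∕ N15 — THE KING-MODEL RUNG (PART Ϸ-l): THE TILTED PAIR — constant links `W_{ν₀} = e^{iaσ₁}`, `W_{ν₁} = cos b·1 + i sin b·σ_φ` with `σ_φ = cos φ·σ₁ + sin φ·σ₂` (the general
# pair of `SU(2)` one-parameter links up to a constant gauge rotation): the planar Bloch bound `⟨σ₁⟩² + ⟨σ_φ⟩² ≤ (1 + cos φ)‖ξ‖⁴` gives the gap
# `Re⟨v,(−cΔ_W+m²)v⟩ ≥ (m² + c·min(sin²a,sin²b)·(1 − cos φ))·Σ‖v_x‖²` on every torus — the mass is proportional to the NON-COMMUTATIVITY `1 − cos φ = 2sin²(φ∕2)` of the axes,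
# while the curvature `‖[W₀,W₁]‖ = 2|sin a sin b sin φ|` is linear in the tilt: the abelian limit `φ → 0` is approached quadratically
# (Track A, DAG node N15 = NE2; FAN-OUT v1.1 §N15 s3 «KING-MODEL RUNG … + what the curved case adds»; count-neutral)

HONEST FRAMING.  Count-neutral (cell `pub-ymgap`, seat `pub-ymgap-dag-n15-e` g48; `--supports stmt-QuantumFields-27247 --as helper` = K3ᴬ, KEY MAP v3).  King's fine covariance layer
`−cΔ_U + m²` (Ͱ-a `covLapF`) at a constant `SU(2)` pair with axes at angle `φ`, `cos φ ≥ 0` (the obtuse case is the acute one with `b ↦ −b`), on ONE finite torus per spacing; elementary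
real algebra per momentum fibre; NOT Bałaban's `G_k(U)`; NOT a node discharge (N15 of record untouched); nothing continuum ∕ ℝ⁴ ∕ OS ∕ Clay.  At `φ = π∕2` this is PART Ϸ-d; at `φ = 0`
the links commute (common eigenvectors, PART Ϸ-h) and the bound is `m²` — consistent.

THE RESULTS (`K` any period vector; `ν₀ ≠ ν₁`; `0 ≤ cos φ`):
* §1 `pauliPhi φ = cos φ·σ₁ + sin φ·σ₂` (`σ_φ² = 1`, Hermitian, unitary), ★ `rot_mem_unitaryGroup_of_sq_one` (`cos b·1 + i sin b·P ∈ U(2)` for every Hermitian involution `P` — structural),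
  `rotPhi φ b`, `norm_sq_sub_smul_rotPhi`, ★ `re_inner_pauliPhi` (`⟨σ_φ⟩ = cos φ⟨σ₁⟩ + sin φ⟨σ₂⟩`), ★★ **`tilted_bloch_le`** (`⟨σ₁⟩² + ⟨σ_φ⟩² ≤ (1 + cos φ)·‖ξ‖⁴`: the top
  eigenvalue `1 + n·m` of `nnᵀ + mmᵀ`; AM–GM `(1−c)u² + (1+c)v² ≥ 2|s||uv|`), ★ `inner_pauliPhi_sq_le` (`⟨σ_φ⟩² ≤ ‖ξ‖⁴`);
* §2 ★★★ **`tilted_fibre_bound`** (`r₀², ρ² ≤ N²`, `r₀² + ρ² ≤ (1+κ)N²` ⟹ `min(β₀²,β₁²)·(1−κ)·N ≤ Σ_μ[2(1−x_μα_μ)N + 2y_μβ_μr_μ]`), `tiltedPauliLink a b φ ν₀ ν₁` + values + unitarity,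
  ★★ `tilted_fibre_coercive` (every momentum);
* §3 ★★★ **`re_quadForm_covLapF_tiltedPauliLink_ge`** (`(m² + c·min(sin²a,sin²b)·(1 − cos φ))·Σ_x‖v_x‖² ≤ Re⟨v,(−cΔ_W+m²)v⟩` on EVERY torus), ★★ `eigenvalues_covLapF_tiltedPauliLink_ge`,
  ★★ `posDef_covLapF_tiltedPauliLink_massless` (`c > 0`, `sin a sin b ≠ 0`, `cos φ < 1`), ★★ `l2_opNorm_covLapF_tiltedPauliLink_massless_inv_le`;
* §4 THE CURVATURE OF THE TILTED PAIR: ★ `rotX_mul_rotPhi_sub` (`[W₀,W₁] = (−2i sin a sin b sin φ)·σ₃`), ★★ **`norm_kingPlaq_tilted_sub_self`** (`‖Pu − u‖ = 2|sin a sin b sin φ|·‖u‖`: constant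
  curvature LINEAR in the tilt), ★★ **`tilted_mass_vs_curvature`** (`1 − cos φ ≤ sin²φ∕…`-free statement: `2(1 − cos φ) ≥ sin²φ` and `1 − cos φ ≤ sin²φ` for `cos φ ≥ 0` — the mass
  constant is squeezed between `½sin²φ` and `sin²φ` times `min(sin²a,sin²b)`: QUADRATIC in the tilt while the curvature is linear).
PRIOR TREE ART (by name): Ϸ-a (`coercive_covLapF_kingConstLink_of_fibre` + corollaries), Ϸ-c (`pauliX∕Y∕Z`, `rotX`, Pauli algebra, `norm_sq_sub_smul_rot`, `norm_sq_sub_smul_rotX`, `re_inner_pauliX∕Y`,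
`bloch_sq_le`, `plaq_sub_one_eq`, `kingPlaq_kingConstLink`, `cos_sq_add_sin_sq_complex`), Ϸ-d (`dressed_direction_ge`, `re_sq_add_im_sq_chi_unitVec`, `min_sin_sq_pos`), Ϸ-j (`pauli_plane_sq`),
Ϸ-b (`re_realCast_mul`), Ͱ-b (`norm_toEuclideanLin_of_mem_unitaryGroup`), Ͻ-q (`kingPlaq`), `TorusSpectral.norm_chi_eq_one`.  Dedup (rg at filing): basename 0 files; needles
`pauliPhi|rotPhi|tiltedPauliLink|tilted_bloch_le|tilted_fibre_bound` 0 tree files.  Locators: [King1986] (2.12) p.653, (4.4) p.670, (4.35) p.674; [Balaban1985BackgroundPropagators] (3.3) p.391,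
(3.23) p.394, (3.39) p.397; [DodziukMathai2006] §1 Cor 1.3.  0 `sorry`, 3 `def`.
-/

noncomputable section

open scoped BigOperators ComplexConjugate ComplexOrder InnerProductSpace
open Finset Matrix WithLp

namespace Summit.QuantumFields.YangMills.BalabanUVNodes.N15KingModelRung.ConstantCurvature

open Literature.MathematicalPhysics.QuantumFieldTheory.Balaban1983to89.B5Prop11Plancherel (Tor unitVec chi)
open Summit.QuantumFields.YangMills.BalabanUVNodes.N15KingModelRung.Covariant (covLapF fib isHermitian_covLapF norm_toEuclideanLin_of_mem_unitaryGroup)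
open Summit.QuantumFields.YangMills.BalabanUVNodes.N15KingModelRung.Cover (kingPlaq)
open Summit.QuantumFields.YangMills.BalabanUVNodes.N15KingModelRung.TorusSpectral (norm_chi_eq_one)

/-! ## §1 The tilted axis, its one-parameter group, and the planar Bloch bound -/

section Tilted

/-- THE TILTED AXIS `σ_φ = cos φ·σ₁ + sin φ·σ₂` (a unit vector in the `σ₁σ₂`-plane at angle `φ` from `σ₁`). [folklore] -/
def pauliPhi (φ : ℝ) : Matrix (Fin 2) (Fin 2) ℂ := (Real.cos φ : ℂ) • pauliX + (Real.sin φ : ℂ) • pauliY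

/-- `σ_φ² = 1`. [folklore] -/
theorem pauliPhi_mul_self (φ : ℝ) : pauliPhi φ * pauliPhi φ = 1 := by
  rw [pauliPhi, pauli_plane_sq, cos_sq_add_sin_sq_complex, one_smul]

/-- `σ_φ` is Hermitian. [folklore] -/
theorem isHermitian_pauliPhi (φ : ℝ) : (pauliPhi φ).IsHermitian := by
  have hsa : ∀ r : ℝ, IsSelfAdjoint ((r : ℝ) : ℂ) := fun r => Complex.conj_ofReal r
  exact (isHermitian_pauliX.smul (hsa _)).add (isHermitian_pauliY.smul (hsa _))

/-- ★ **`cos b·1 + i sin b·P ∈ U(2)` FOR EVERY HERMITIAN INVOLUTION `P`** (`P^* = P`, `P² = 1`): `(c + isP)(c − isP) = (c² + s²)·1`. [folklore] -/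
theorem rot_mem_unitaryGroup_of_sq_one {P : Matrix (Fin 2) (Fin 2) ℂ} (hPH : P.IsHermitian) (hP2 : P * P = 1) (b : ℝ) :
    (Real.cos b : ℂ) • (1 : Matrix (Fin 2) (Fin 2) ℂ) + ((Real.sin b : ℂ) * Complex.I) • P ∈ Matrix.unitaryGroup (Fin 2) ℂ := by
  rw [Matrix.mem_unitaryGroup_iff, Matrix.star_eq_conjTranspose, conjTranspose_add, conjTranspose_smul, conjTranspose_smul, conjTranspose_one, hPH.eq]
  have h1 : star ((Real.cos b : ℂ)) = (Real.cos b : ℂ) := Complex.conj_ofReal _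
  have h2 : star ((Real.sin b : ℂ) * Complex.I) = -((Real.sin b : ℂ) * Complex.I) := by
    simp [Complex.conj_ofReal, Complex.conj_I, -Complex.ofReal_sin, -Complex.ofReal_cos]
  rw [h1, h2]
  have key : ((Real.cos b : ℂ) • (1 : Matrix (Fin 2) (Fin 2) ℂ) + ((Real.sin b : ℂ) * Complex.I) • P)
      * ((Real.cos b : ℂ) • (1 : Matrix (Fin 2) (Fin 2) ℂ) + (-((Real.sin b : ℂ) * Complex.I)) • P)
      = ((Real.cos b : ℂ) * (Real.cos b : ℂ) + ((Real.sin b : ℂ) * Complex.I) * (-((Real.sin b : ℂ) * Complex.I))) • (1 : Matrix (Fin 2) (Fin 2) ℂ)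
        + ((Real.cos b : ℂ) * (-((Real.sin b : ℂ) * Complex.I)) + ((Real.sin b : ℂ) * Complex.I) * (Real.cos b : ℂ)) • P := by
    rw [add_mul, mul_add, mul_add, smul_mul_smul, smul_mul_smul, smul_mul_smul, smul_mul_smul, Matrix.one_mul, Matrix.mul_one, Matrix.one_mul, hP2, add_smul, add_smul]
    abel
  have hcs := cos_sq_add_sin_sq_complex b
  rw [key, show (Real.cos b : ℂ) * (-((Real.sin b : ℂ) * Complex.I)) + ((Real.sin b : ℂ) * Complex.I) * (Real.cos b : ℂ) = 0 by ring, zero_smul, add_zero,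
    show (Real.cos b : ℂ) * (Real.cos b : ℂ) + ((Real.sin b : ℂ) * Complex.I) * (-((Real.sin b : ℂ) * Complex.I)) = 1 by linear_combination hcs - (Real.sin b : ℂ) ^ 2 * Complex.I_sq,
    one_smul]

/-- `σ_φ ∈ U(2)`. [folklore] -/
theorem pauliPhi_mem_unitaryGroup (φ : ℝ) : pauliPhi φ ∈ Matrix.unitaryGroup (Fin 2) ℂ := by
  rw [Matrix.mem_unitaryGroup_iff, Matrix.star_eq_conjTranspose, (isHermitian_pauliPhi φ).eq, pauliPhi_mul_self]

/-- THE TILTED LINK `e^{ibσ_φ} = cos b·1 + i sin b·σ_φ`. [folklore] -/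
def rotPhi (φ b : ℝ) : Matrix (Fin 2) (Fin 2) ℂ := (Real.cos b : ℂ) • (1 : Matrix (Fin 2) (Fin 2) ℂ) + ((Real.sin b : ℂ) * Complex.I) • pauliPhi φ

/-- `e^{ibσ_φ} ∈ U(2)`. [folklore] -/
theorem rotPhi_mem_unitaryGroup (φ b : ℝ) : rotPhi φ b ∈ Matrix.unitaryGroup (Fin 2) ℂ :=
  rot_mem_unitaryGroup_of_sq_one (isHermitian_pauliPhi φ) (pauliPhi_mul_self φ) b

/-- `‖ξ − ψ·e^{ibσ_φ}ξ‖² = 2(1 − Re ψ cos b)‖ξ‖² + 2 Im ψ sin b·Re⟪ξ,σ_φξ⟫`. [cite: Balaban1985BackgroundPropagators, (3.3) p.391] -/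
theorem norm_sq_sub_smul_rotPhi (φ b : ℝ) {ψ : ℂ} (hψ : ‖ψ‖ = 1) (ξ : EuclideanSpace ℂ (Fin 2)) :
    ‖ξ - ψ • Matrix.toEuclideanLin (rotPhi φ b) ξ‖ ^ 2
      = 2 * (1 - ψ.re * Real.cos b) * ‖ξ‖ ^ 2 + 2 * ψ.im * Real.sin b * RCLike.re ⟪ξ, Matrix.toEuclideanLin (pauliPhi φ) ξ⟫_ℂ :=
  norm_sq_sub_smul_rot (isHermitian_pauliPhi φ) rfl (rotPhi_mem_unitaryGroup φ b) hψ ξ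

/-- ★ `⟨σ_φ⟩_ξ = cos φ·⟨σ₁⟩_ξ + sin φ·⟨σ₂⟩_ξ`. [folklore] -/
theorem re_inner_pauliPhi (φ : ℝ) (ξ : EuclideanSpace ℂ (Fin 2)) :
    RCLike.re ⟪ξ, Matrix.toEuclideanLin (pauliPhi φ) ξ⟫_ℂ
      = Real.cos φ * RCLike.re ⟪ξ, Matrix.toEuclideanLin pauliX ξ⟫_ℂ + Real.sin φ * RCLike.re ⟪ξ, Matrix.toEuclideanLin pauliY ξ⟫_ℂ := by
  rw [pauliPhi, map_add, map_smul, map_smul, LinearMap.add_apply, LinearMap.smul_apply, LinearMap.smul_apply, inner_add_right, inner_smul_right, inner_smul_right, map_add,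
    re_realCast_mul, re_realCast_mul]

/-- The planar Gram bound: for `c² + s² = 1`, `0 ≤ c`: `u² + (cu + sv)² ≤ (1 + c)(u² + v²)` (AM–GM `(1−c)u² + (1+c)v² ≥ 2|s||u||v|`). [folklore] -/
theorem planar_gram_le {c s : ℝ} (hcs : c ^ 2 + s ^ 2 = 1) (hc : 0 ≤ c) (u v : ℝ) : u ^ 2 + (c * u + s * v) ^ 2 ≤ (1 + c) * (u ^ 2 + v ^ 2) := by
  have hc1 : c ≤ 1 := by nlinarith [sq_nonneg s]
  have hp2 : Real.sqrt (1 - c) ^ 2 = 1 - c := Real.sq_sqrt (by linarith)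
  have hr2 : Real.sqrt (1 + c) ^ 2 = 1 + c := Real.sq_sqrt (by linarith)
  have hpr : Real.sqrt (1 - c) * Real.sqrt (1 + c) = |s| := by
    rw [← Real.sqrt_mul' _ (by linarith), show (1 - c) * (1 + c) = s ^ 2 by nlinarith [hcs], Real.sqrt_sq_eq_abs]
  have h3 : s * u * v ≤ |s| * |u| * |v| := by rw [← abs_mul, ← abs_mul]; exact le_abs_self _
  have hsq : (Real.sqrt (1 - c) * |u| - Real.sqrt (1 + c) * |v|) ^ 2 = (1 - c) * u ^ 2 + (1 + c) * v ^ 2 - 2 * |s| * |u| * |v| := by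
    have : (Real.sqrt (1 - c) * |u| - Real.sqrt (1 + c) * |v|) ^ 2
        = Real.sqrt (1 - c) ^ 2 * |u| ^ 2 + Real.sqrt (1 + c) ^ 2 * |v| ^ 2 - 2 * (Real.sqrt (1 - c) * Real.sqrt (1 + c)) * |u| * |v| := by ring
    rw [this, hp2, hr2, hpr, sq_abs, sq_abs]
  have hE : 0 ≤ (1 - c) * u ^ 2 + (1 + c) * v ^ 2 - 2 * s * u * v := by nlinarith [sq_nonneg (Real.sqrt (1 - c) * |u| - Real.sqrt (1 + c) * |v|)]
  have hs2 : s ^ 2 = 1 - c ^ 2 := by linarith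
  nlinarith [mul_nonneg hc hE, hs2]

/-- ★★ **THE TILTED BLOCH BOUND**: `⟨σ₁⟩_ξ² + ⟨σ_φ⟩_ξ² ≤ (1 + cos φ)·‖ξ‖⁴` for `cos φ ≥ 0` (the Bloch vector has length `‖ξ‖²`, and `nnᵀ + mmᵀ ≤ (1 + n·m)·1` for unit `n, m`). [folklore] -/
theorem tilted_bloch_le {φ : ℝ} (hφ : 0 ≤ Real.cos φ) (ξ : EuclideanSpace ℂ (Fin 2)) :
    (RCLike.re ⟪ξ, Matrix.toEuclideanLin pauliX ξ⟫_ℂ) ^ 2 + (RCLike.re ⟪ξ, Matrix.toEuclideanLin (pauliPhi φ) ξ⟫_ℂ) ^ 2 ≤ (1 + Real.cos φ) * (‖ξ‖ ^ 2) ^ 2 := by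
  rw [re_inner_pauliPhi]
  have hB := bloch_sq_le ξ
  have hG := planar_gram_le (Real.cos_sq_add_sin_sq φ) hφ (RCLike.re ⟪ξ, Matrix.toEuclideanLin pauliX ξ⟫_ℂ) (RCLike.re ⟪ξ, Matrix.toEuclideanLin pauliY ξ⟫_ℂ)
  nlinarith [mul_le_mul_of_nonneg_left hB (by linarith : (0 : ℝ) ≤ 1 + Real.cos φ)]

/-- ★ `⟨σ_φ⟩_ξ² ≤ ‖ξ‖⁴` (Cauchy–Schwarz in the plane + the Bloch constraint). [folklore] -/
theorem inner_pauliPhi_sq_le (φ : ℝ) (ξ : EuclideanSpace ℂ (Fin 2)) : (RCLike.re ⟪ξ, Matrix.toEuclideanLin (pauliPhi φ) ξ⟫_ℂ) ^ 2 ≤ (‖ξ‖ ^ 2) ^ 2 := by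
  rw [re_inner_pauliPhi]
  have hB := bloch_sq_le ξ
  have hcs := Real.cos_sq_add_sin_sq φ
  set u := RCLike.re ⟪ξ, Matrix.toEuclideanLin pauliX ξ⟫_ℂ
  set v := RCLike.re ⟪ξ, Matrix.toEuclideanLin pauliY ξ⟫_ℂ
  have hCS : (Real.cos φ * u + Real.sin φ * v) ^ 2 ≤ (Real.cos φ ^ 2 + Real.sin φ ^ 2) * (u ^ 2 + v ^ 2) := by
    nlinarith [sq_nonneg (Real.cos φ * v - Real.sin φ * u)]
  rw [hcs, one_mul] at hCS
  exact hCS.trans hB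

end Tilted

/-! ## §2 The tilted fibre lemma and the tilted link field -/

section Fibre

/-- ★★★ **THE TILTED FIBRE LEMMA**: two dressed directions (phases on the unit circle, link angles `(α_μ,β_μ)`), `N ≥ 0`, Bloch components with `r₀² ≤ N²`, `ρ² ≤ N²` and
`r₀² + ρ² ≤ (1+κ)N²`: `min(β₀²,β₁²)·(1−κ)·N ≤ Σ_μ[2(1−x_μα_μ)N + 2y_μβ_μr_μ]`. [folklore] -/
theorem tilted_fibre_bound {x₀ y₀ x₁ y₁ α₀ β₀ α₁ β₁ N r₀ ρ κ : ℝ} (h0 : x₀ ^ 2 + y₀ ^ 2 = 1) (h1 : x₁ ^ 2 + y₁ ^ 2 = 1) (hα0 : α₀ ^ 2 + β₀ ^ 2 = 1) (hα1 : α₁ ^ 2 + β₁ ^ 2 = 1)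
    (hN : 0 ≤ N) (hr0 : r₀ ^ 2 ≤ N ^ 2) (hρ : ρ ^ 2 ≤ N ^ 2) (hsum : r₀ ^ 2 + ρ ^ 2 ≤ (1 + κ) * N ^ 2) :
    min (β₀ ^ 2) (β₁ ^ 2) * (1 - κ) * N ≤ (2 * (1 - x₀ * α₀) * N + 2 * y₀ * β₀ * r₀) + (2 * (1 - x₁ * α₁) * N + 2 * y₁ * β₁ * ρ) := by
  have e0 := dressed_direction_ge x₀ y₀ α₀ β₀ N r₀ h0 hα0
  have e1 := dressed_direction_ge x₁ y₁ α₁ β₁ N ρ h1 hα1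
  have hm0 : min (β₀ ^ 2) (β₁ ^ 2) ≤ β₀ ^ 2 := min_le_left _ _
  have hm1 : min (β₀ ^ 2) (β₁ ^ 2) ≤ β₁ ^ 2 := min_le_right _ _
  have hmin0 : 0 ≤ min (β₀ ^ 2) (β₁ ^ 2) := le_min (sq_nonneg _) (sq_nonneg _)
  have hpos0 : 0 ≤ N ^ 2 - r₀ ^ 2 := by linarith
  have hpos1 : 0 ≤ N ^ 2 - ρ ^ 2 := by linarith
  rcases eq_or_lt_of_le hN with hN0 | hNpos
  · have hr0' : r₀ = 0 := by nlinarith [sq_nonneg r₀]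
    have hρ' : ρ = 0 := by nlinarith [sq_nonneg ρ]
    rw [← hN0, hr0', hρ']; simp
  · have key : min (β₀ ^ 2) (β₁ ^ 2) * (1 - κ) * N * N ≤ ((2 * (1 - x₀ * α₀) * N + 2 * y₀ * β₀ * r₀) + (2 * (1 - x₁ * α₁) * N + 2 * y₁ * β₁ * ρ)) * N := by
      nlinarith [mul_le_mul_of_nonneg_right hm0 hpos0, mul_le_mul_of_nonneg_right hm1 hpos1, mul_le_mul_of_nonneg_left hsum hmin0]
    exact le_of_mul_le_mul_right key hNpos

variable {d : ℕ} (K : Fin (d + 1) → ℕ)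

/-- THE TILTED PAULI LINK FIELD: `W_{ν₀} = e^{iaσ₁}`, `W_{ν₁} = e^{ibσ_φ}`, `W_μ = 1` otherwise. [cite: King1986, (2.12) p.653; Balaban1985BackgroundPropagators, (3.3) p.391] -/
def tiltedPauliLink (a b φ : ℝ) (ν₀ ν₁ : Fin (d + 1)) : Fin (d + 1) → Matrix (Fin 2) (Fin 2) ℂ :=
  fun μ => if μ = ν₀ then rotX a else if μ = ν₁ then rotPhi φ b else 1

/-- `W_{ν₀} = e^{iaσ₁}`. [folklore] -/
@[simp] theorem tiltedPauliLink_fst (a b φ : ℝ) (ν₀ ν₁ : Fin (d + 1)) : tiltedPauliLink (d := d) a b φ ν₀ ν₁ ν₀ = rotX a := by simp [tiltedPauliLink]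
/-- `W_{ν₁} = e^{ibσ_φ}` (`ν₀ ≠ ν₁`). [folklore] -/
theorem tiltedPauliLink_snd (a b φ : ℝ) {ν₀ ν₁ : Fin (d + 1)} (hν : ν₀ ≠ ν₁) : tiltedPauliLink (d := d) a b φ ν₀ ν₁ ν₁ = rotPhi φ b := by
  simp [tiltedPauliLink, Ne.symm hν]
/-- The tilted field is unitary. [folklore] -/
theorem tiltedPauliLink_mem_unitaryGroup (a b φ : ℝ) (ν₀ ν₁ μ : Fin (d + 1)) : tiltedPauliLink (d := d) a b φ ν₀ ν₁ μ ∈ Matrix.unitaryGroup (Fin 2) ℂ := by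
  unfold tiltedPauliLink
  split_ifs
  · exact rotX_mem_unitaryGroup a
  · exact rotPhi_mem_unitaryGroup φ b
  · exact Submonoid.one_mem _

variable [hK : ∀ μ, NeZero (K μ)]

/-- ★★ **THE TILTED FIBRE IS COERCIVE, UNIFORMLY IN THE MOMENTUM** (`c ≥ 0`, `cos φ ≥ 0`, `ν₀ ≠ ν₁`):
`(m² + c·min(sin²a,sin²b)·(1 − cos φ))‖ξ‖² ≤ m²‖ξ‖² + cΣ_μ‖ξ − ψ_μ(q)W_μξ‖²`. [cite: King1986, (4.4) p.670, (4.35) p.674; Balaban1985BackgroundPropagators, (3.23) p.394] -/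
theorem tilted_fibre_coercive {c : ℝ} (hc : 0 ≤ c) (m2 a b : ℝ) {φ : ℝ} (hφ : 0 ≤ Real.cos φ) {ν₀ ν₁ : Fin (d + 1)} (hν : ν₀ ≠ ν₁) (q : Tor K) (ξ : EuclideanSpace ℂ (Fin 2)) :
    (m2 + c * (min (Real.sin a ^ 2) (Real.sin b ^ 2) * (1 - Real.cos φ))) * ‖ξ‖ ^ 2
      ≤ m2 * ‖ξ‖ ^ 2 + c * ∑ μ, ‖ξ - chi K q (unitVec K μ) • Matrix.toEuclideanLin (tiltedPauliLink (d := d) a b φ ν₀ ν₁ μ) ξ‖ ^ 2 := by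
  have hdrop : ‖ξ - chi K q (unitVec K ν₀) • Matrix.toEuclideanLin (tiltedPauliLink (d := d) a b φ ν₀ ν₁ ν₀) ξ‖ ^ 2
      + ‖ξ - chi K q (unitVec K ν₁) • Matrix.toEuclideanLin (tiltedPauliLink (d := d) a b φ ν₀ ν₁ ν₁) ξ‖ ^ 2
      ≤ ∑ μ, ‖ξ - chi K q (unitVec K μ) • Matrix.toEuclideanLin (tiltedPauliLink (d := d) a b φ ν₀ ν₁ μ) ξ‖ ^ 2 := by
    have hpair : ∑ μ ∈ ({ν₀, ν₁} : Finset (Fin (d + 1))), ‖ξ - chi K q (unitVec K μ) • Matrix.toEuclideanLin (tiltedPauliLink (d := d) a b φ ν₀ ν₁ μ) ξ‖ ^ 2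
        = ‖ξ - chi K q (unitVec K ν₀) • Matrix.toEuclideanLin (tiltedPauliLink (d := d) a b φ ν₀ ν₁ ν₀) ξ‖ ^ 2
          + ‖ξ - chi K q (unitVec K ν₁) • Matrix.toEuclideanLin (tiltedPauliLink (d := d) a b φ ν₀ ν₁ ν₁) ξ‖ ^ 2 := Finset.sum_pair hν
    rw [← hpair]
    exact Finset.sum_le_sum_of_subset_of_nonneg (Finset.subset_univ _) fun _ _ _ => sq_nonneg _
  rw [tiltedPauliLink_fst, tiltedPauliLink_snd a b φ hν, norm_sq_sub_smul_rotX a (norm_chi_eq_one K q (unitVec K ν₀)) ξ,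
    norm_sq_sub_smul_rotPhi φ b (norm_chi_eq_one K q (unitVec K ν₁)) ξ] at hdrop
  have hsq1 : (RCLike.re ⟪ξ, Matrix.toEuclideanLin pauliX ξ⟫_ℂ) ^ 2 ≤ (‖ξ‖ ^ 2) ^ 2 := by nlinarith [bloch_sq_le ξ, sq_nonneg (RCLike.re ⟪ξ, Matrix.toEuclideanLin pauliY ξ⟫_ℂ)]
  have hfib := tilted_fibre_bound (re_sq_add_im_sq_chi_unitVec K q ν₀) (re_sq_add_im_sq_chi_unitVec K q ν₁) (Real.cos_sq_add_sin_sq a) (Real.cos_sq_add_sin_sq b)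
    (sq_nonneg ‖ξ‖) hsq1 (inner_pauliPhi_sq_le φ ξ) (tilted_bloch_le hφ ξ)
  have hmin : min (Real.sin a ^ 2) (Real.sin b ^ 2) * (1 - Real.cos φ) * ‖ξ‖ ^ 2
      ≤ ∑ μ, ‖ξ - chi K q (unitVec K μ) • Matrix.toEuclideanLin (tiltedPauliLink (d := d) a b φ ν₀ ν₁ μ) ξ‖ ^ 2 := hfib.trans hdrop
  nlinarith [mul_le_mul_of_nonneg_left hmin hc]

end Fibre

/-! ## §3 The gap of the tilted pair on the torus -/

section Torus

variable {d : ℕ} (K : Fin (d + 1) → ℕ) [hK : ∀ μ, NeZero (K μ)]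

/-- ★★★ **THE GAP OF THE TILTED PAIR**: on EVERY torus, for `c ≥ 0`, `cos φ ≥ 0`, `ν₀ ≠ ν₁`:
`(m² + c·min(sin²a,sin²b)·(1 − cos φ))·Σ_x‖v_x‖² ≤ Re⟨v,(−cΔ_W+m²)v⟩` — the mass is proportional to the non-commutativity `1 − cos φ = 2sin²(φ∕2)` of the two axes; `φ = π∕2` is PART Ϸ-d,
`φ = 0` (commuting links) gives `m²`. [cite: King1986, (4.4) p.670, (4.35) p.674; Balaban1985BackgroundPropagators, (3.23) p.394; DodziukMathai2006, Cor 1.3 §1] -/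
theorem re_quadForm_covLapF_tiltedPauliLink_ge {c : ℝ} (hc : 0 ≤ c) (m2 a b : ℝ) {φ : ℝ} (hφ : 0 ≤ Real.cos φ) {ν₀ ν₁ : Fin (d + 1)} (hν : ν₀ ≠ ν₁) (v : Tor K × Fin 2 → ℂ) :
    (m2 + c * (min (Real.sin a ^ 2) (Real.sin b ^ 2) * (1 - Real.cos φ))) * ∑ x, ‖fib K v x‖ ^ 2
      ≤ RCLike.re (star v ⬝ᵥ (covLapF K c m2 (kingConstLink K (tiltedPauliLink a b φ ν₀ ν₁)) *ᵥ v)) :=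
  coercive_covLapF_kingConstLink_of_fibre K (tiltedPauliLink_mem_unitaryGroup a b φ ν₀ ν₁) c m2 (fun q ξ => tilted_fibre_coercive K hc m2 a b hφ hν q ξ) v

/-- ★★ EVERY EIGENVALUE `≥ m² + c·min(sin²a,sin²b)·(1 − cos φ)`. [cite: King1986, (4.4) p.670; Balaban1985BackgroundPropagators, (3.23) p.394] -/
theorem eigenvalues_covLapF_tiltedPauliLink_ge {c : ℝ} (hc : 0 ≤ c) (m2 a b : ℝ) {φ : ℝ} (hφ : 0 ≤ Real.cos φ) {ν₀ ν₁ : Fin (d + 1)} (hν : ν₀ ≠ ν₁) (i : Tor K × Fin 2) :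
    m2 + c * (min (Real.sin a ^ 2) (Real.sin b ^ 2) * (1 - Real.cos φ)) ≤ (isHermitian_covLapF K c m2 (kingConstLink K (tiltedPauliLink a b φ ν₀ ν₁))).eigenvalues i :=
  eigenvalues_covLapF_kingConstLink_ge_of_fibre K (tiltedPauliLink_mem_unitaryGroup a b φ ν₀ ν₁) c m2 (fun q ξ => tilted_fibre_coercive K hc m2 a b hφ hν q ξ) i

/-- ★★ **THE MASSLESS TILTED OPERATOR IS POSITIVE DEFINITE** as soon as both links are dressed (`sin a sin b ≠ 0`) and the axes are NOT parallel (`cos φ < 1`), `c > 0`.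
[cite: DodziukMathai2006, Cor 1.3 §1; Balaban1985BackgroundPropagators, (3.23) p.394] -/
theorem posDef_covLapF_tiltedPauliLink_massless {c : ℝ} (hc : 0 < c) {a b : ℝ} (ha : Real.sin a ≠ 0) (hb : Real.sin b ≠ 0) {φ : ℝ} (hφ : 0 ≤ Real.cos φ) (hφ1 : Real.cos φ < 1)
    {ν₀ ν₁ : Fin (d + 1)} (hν : ν₀ ≠ ν₁) : (covLapF K c 0 (kingConstLink K (tiltedPauliLink a b φ ν₀ ν₁))).PosDef := by
  have hκ : 0 < (0 : ℝ) + c * (min (Real.sin a ^ 2) (Real.sin b ^ 2) * (1 - Real.cos φ)) := by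
    rw [zero_add]; exact mul_pos hc (mul_pos (min_sin_sq_pos ha hb) (by linarith))
  exact posDef_covLapF_kingConstLink_of_fibre K (tiltedPauliLink_mem_unitaryGroup a b φ ν₀ ν₁) c 0 hκ (fun q ξ => tilted_fibre_coercive K hc.le 0 a b hφ hν q ξ)

open scoped Matrix.Norms.L2Operator in
/-- ★★ `‖(−cΔ_W)⁻¹‖_{ℓ²→ℓ²} ≤ (c·min(sin²a,sin²b)·(1 − cos φ))⁻¹` (`c > 0`, `sin a sin b ≠ 0`, `0 ≤ cos φ < 1`), every torus.
[cite: Balaban1985BackgroundPropagators, (3.39) p.397; King1986, (4.4) p.670] -/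
theorem l2_opNorm_covLapF_tiltedPauliLink_massless_inv_le {c : ℝ} (hc : 0 < c) {a b : ℝ} (ha : Real.sin a ≠ 0) (hb : Real.sin b ≠ 0) {φ : ℝ} (hφ : 0 ≤ Real.cos φ) (hφ1 : Real.cos φ < 1)
    {ν₀ ν₁ : Fin (d + 1)} (hν : ν₀ ≠ ν₁) :
    ‖(covLapF K c 0 (kingConstLink K (tiltedPauliLink a b φ ν₀ ν₁)))⁻¹‖ ≤ (c * (min (Real.sin a ^ 2) (Real.sin b ^ 2) * (1 - Real.cos φ)))⁻¹ := by
  have hκ : 0 < (0 : ℝ) + c * (min (Real.sin a ^ 2) (Real.sin b ^ 2) * (1 - Real.cos φ)) := by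
    rw [zero_add]; exact mul_pos hc (mul_pos (min_sin_sq_pos ha hb) (by linarith))
  have h := l2_opNorm_covLapF_kingConstLink_inv_le_of_fibre K (tiltedPauliLink_mem_unitaryGroup a b φ ν₀ ν₁) c 0 hκ (fun q ξ => tilted_fibre_coercive K hc.le 0 a b hφ hν q ξ)
  rwa [zero_add] at h

end Torus

/-! ## §4 The curvature of the tilted pair: linear in the tilt -/

section Curvature

variable {d : ℕ} (K : Fin (d + 1) → ℕ)

/-- `e^{ibσ_φ}` as a matrix: `[[cos b, i sin b(cos φ − i sin φ)],[i sin b(cos φ + i sin φ), cos b]]`. [folklore] -/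
theorem rotPhi_eq_matrix (φ b : ℝ) :
    rotPhi φ b = !![(Real.cos b : ℂ), (Real.sin b : ℂ) * Complex.I * ((Real.cos φ : ℂ) - (Real.sin φ : ℂ) * Complex.I);
      (Real.sin b : ℂ) * Complex.I * ((Real.cos φ : ℂ) + (Real.sin φ : ℂ) * Complex.I), (Real.cos b : ℂ)] := by
  ext i j; fin_cases i <;> fin_cases j <;> simp [rotPhi, pauliPhi, pauliX, pauliY, -Complex.ofReal_cos, -Complex.ofReal_sin]
  left; ring1

/-- ★ **THE COMMUTATOR OF THE TILTED LINKS**: `e^{iaσ₁}e^{ibσ_φ} − e^{ibσ_φ}e^{iaσ₁} = (−2i·sin a·sin b·sin φ)·σ₃` (`[σ₁,σ_φ] = 2i sin φ·σ₃`). [folklore] -/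
theorem rotX_mul_rotPhi_sub (a b φ : ℝ) : rotX a * rotPhi φ b - rotPhi φ b * rotX a = (-(2 : ℂ) * Complex.I * Real.sin a * Real.sin b * Real.sin φ) • pauliZ := by
  rw [rotPhi_eq_matrix]
  ext i j; fin_cases i <;> fin_cases j <;> simp [rotX, pauliZ, -Complex.ofReal_cos, -Complex.ofReal_sin]
  all_goals apply Complex.ext <;> simp [Complex.mul_re, Complex.mul_im] <;> ring

/-- ★★ **CONSTANT CURVATURE, LINEAR IN THE TILT**: `‖Pu − u‖ = 2|sin a·sin b·sin φ|·‖u‖` for every `u` at every site. [cite: King1986, (2.12) p.653; DodziukMathai2006, Cor 1.3 §1] -/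
theorem norm_kingPlaq_tilted_sub_self (a b φ : ℝ) {ν₀ ν₁ : Fin (d + 1)} (hν : ν₀ ≠ ν₁) (x : Tor K) (u : EuclideanSpace ℂ (Fin 2)) :
    ‖Matrix.toEuclideanLin (kingPlaq K (kingConstLink K (tiltedPauliLink a b φ ν₀ ν₁)) x ν₀ ν₁) u - u‖ = 2 * |Real.sin a * Real.sin b * Real.sin φ| * ‖u‖ := by
  set P := kingPlaq K (kingConstLink K (tiltedPauliLink a b φ ν₀ ν₁)) x ν₀ ν₁ with hP
  have hP1 : P - 1 = ((-(2 : ℂ) * Complex.I * Real.sin a * Real.sin b * Real.sin φ) • pauliZ) * ((rotX a)ᴴ * (rotPhi φ b)ᴴ) := by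
    rw [hP, kingPlaq_kingConstLink, tiltedPauliLink_fst, tiltedPauliLink_snd a b φ hν, plaq_sub_one_eq (rotX_mem_unitaryGroup a) (rotPhi_mem_unitaryGroup φ b), rotX_mul_rotPhi_sub]
  have h1 : Matrix.toEuclideanLin P u - u = Matrix.toEuclideanLin (P - 1) u := by
    rw [map_sub, LinearMap.sub_apply, Matrix.toLpLin_one, LinearMap.id_apply]
  have hV : (rotX a)ᴴ * (rotPhi φ b)ᴴ ∈ Matrix.unitaryGroup (Fin 2) ℂ := by
    refine Submonoid.mul_mem _ ?_ ?_
    · simpa only [Matrix.star_eq_conjTranspose] using Unitary.star_mem (rotX_mem_unitaryGroup a)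
    · simpa only [Matrix.star_eq_conjTranspose] using Unitary.star_mem (rotPhi_mem_unitaryGroup φ b)
  rw [h1, hP1, Matrix.toLpLin_apply, ← Matrix.mulVec_mulVec, Matrix.smul_mulVec, WithLp.toLp_smul, norm_smul]
  have h2 : ‖(toLp 2 (pauliZ *ᵥ (((rotX a)ᴴ * (rotPhi φ b)ᴴ) *ᵥ ofLp u)) : EuclideanSpace ℂ (Fin 2))‖ = ‖u‖ := by
    have e1 := norm_toEuclideanLin_of_mem_unitaryGroup pauliZ_mem_unitaryGroup (toLp 2 (((rotX a)ᴴ * (rotPhi φ b)ᴴ) *ᵥ ofLp u) : EuclideanSpace ℂ (Fin 2))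
    have e2 := norm_toEuclideanLin_of_mem_unitaryGroup hV u
    rw [Matrix.toLpLin_apply, ofLp_toLp] at e1
    rw [Matrix.toLpLin_apply] at e2
    rw [e1, e2]
  rw [h2]
  congr 1
  rw [norm_mul, norm_mul, norm_mul, norm_mul, norm_neg, Complex.norm_I, Complex.norm_real, Complex.norm_real, Complex.norm_real, mul_one, abs_mul, abs_mul]
  norm_num
  ring

/-- ★★ **MASS QUADRATIC, CURVATURE LINEAR IN THE TILT**: for `cos φ ≥ 0`, `½·sin²φ ≤ 1 − cos φ ≤ sin²φ` — so the gap constant `min(sin²a,sin²b)(1 − cos φ)` is comparable to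
`min(sin²a,sin²b)·sin²φ` while the curvature is `2|sin a sin b|·|sin φ|`: as the axes align (`φ → 0`) the abelian, massless limit is approached QUADRATICALLY. [folklore] -/
theorem tilted_mass_vs_curvature {φ : ℝ} (hφ : 0 ≤ Real.cos φ) : Real.sin φ ^ 2 / 2 ≤ 1 - Real.cos φ ∧ 1 - Real.cos φ ≤ Real.sin φ ^ 2 := by
  have hcs := Real.sin_sq_add_cos_sq φ
  have hc1 := Real.cos_le_one φ
  constructor
  · nlinarith
  · nlinarith

end Curvature

end Summit.QuantumFields.YangMills.BalabanUVNodes.N15KingModelRung.ConstantCurvature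

end
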